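import Summits.BirchSwinnertonDyer.BirchSwinnertonDyer.Theorems.SignedLowerHalvesKobayashiMainConjectureSmallImageTeichSpanHeckeModPrelims
import Summits.BirchSwinnertonDyer.BirchSwinnertonDyer.Theorems.SignedLowerHalvesKobayashiMainConjectureSmallImageTeichSpanHecke
import HarnessLib

/-!
# Route `SignedLowerHalves`, crux `KobayashiMainConjectureSmallImage` (item stmt-BirchSwinnertonDyer-19002), line `birth_acns` v12,
# stub `stub_muOneSign_ns_ge5`: **the one-sign μ-rider ⟸ B⁰ MODULO THE HECKE RELATORS OF THE NEWFORM** (second cut of B⁰_ss: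
# an arbitrary relator set `G` killed by Manin's homomorphism; cell `bsd-ssimc`, seat `bsd-line-slh-p3` gen 10, LEAD; THEOREMS ONLY; helper)

First cut (p652976 `…TeichSpanHecke`): the rider ⟸ B⁰ modulo the `T_p`-images (`a_p ≡ 0`).  The dictionary only uses of a relator that
Manin's homomorphism `m` of the newform kills it mod `p` once `[0]⁺ ≡ 0` — `IsManinKilled f p G` (`…TeichSpanHeckeRelatorDefs`).  So:

* §B `exists_one_le_norm_teichOrbitSum_of_teichSpanGenMod` — LEVEL FORM for ANY relator set `G`: `f` rational newform on `Γ₀(N)`, `p` odd,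
  `p ∤ N`, `p ∣ a_p(f)`, Eisenstein multiple prime to `p`; «B⁰ modulo `G`» (`TeichSpanGenMod N p G`) + `IsManinKilled f p G` + winding
  non-constancy mod `p` ⟹ SOME Teichmüller-orbit sum `S_f(p,n,b)` (`n ≥ 1`) has norm `≥ 1`.  (Contrapositive as in the f3-mu dictionary:
  all `S ≡ 0` ⟹ `[0]⁺ ≡ 0` ⟹ `m mod p` kills packets, torsion, parabolics, `p`-th powers, commutators and — by `IsManinKilled` — `G` ⟹
  `2m(γ) ≡ 0` on good `γ` ⟹ constant winding function, contradiction.)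
* §C `exists_sign_hasUnitContent_of_teichSpanGenMod_heckeRelators` — CURVE FORM at any odd good supersingular `p` with `a_p = 0`:
  **rider ⟸ B⁰ modulo `heckeRelators f p`** (the `T_p`-images and the `T_ℓ`-images of every prime `ℓ ∤ Np` with `p ∣ a_ℓ(f)`; killed by
  `isManinKilled_heckeRelators`).  For the crux's population (`ρ̄_{E,p}` onto the normaliser of a non-split Cartan, quadratic field `K`)
  these include `T_ℓ` for EVERY good `ℓ` inert in `K`, so the hypothesis only concerns the `K`-DIHEDRAL residually supersingular
  eigensystems of level `N_E` — the congruence class of `f` itself (CM forms by `K` with `p` inert live there).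
* §D `muOneSign_ns_ge5_of_teichSpanGenMod_heckeRelators_conductor` — the registered stub `stub_muOneSign_ns_ge5` (line `birth_acns` v12),
  VERBATIM, from «B⁰ modulo the Hecke relators of the newform, at the conductor level, for every pair of the class» — inside the first
  cut's hypothesis (`teichSpanGenMod_heckeRelators_of_teichSpanGenModHecke`), itself inside p648205's B⁰.
HONEST SCOPE: no instance of «B⁰ modulo `G`» is proved here; the stub is NOT discharged; crux 4 stays OPEN; BSD is not proved by any of
this; no summit statement is proved by this seat.
References: [Manin1972] 1.4; [MazurTateTeitelbaum1986Invent] §I.4, §I.10; [Pollack2003] 6.15–6.16; [PollackWeston2011] 4.1–4.2; [Serre1972] Prop. 12.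
-/

-- D-0017: single-problem summit, the namespace repeats the problem name by design.
set_option linter.dupNamespace false
set_option autoImplicit false

noncomputable section

open scoped Classical MatrixGroups ModularForm
open CongruenceSubgroup Literature.NumberTheory.EllipticCurves.Rank1Residual

namespace Summit.BirchSwinnertonDyer.BirchSwinnertonDyer.Theorems.SmallImageTeichSpanHeckeMod

open Matrix Matrix.SpecialLinearGroup Polynomial
  Literature.NumberTheory.EllipticCurves Literature.NumberTheory.EllipticCurves.ModularForms
  Literature.NumberTheory.EllipticCurves.Kobayashi2003 Literature.NumberTheory.EllipticCurves.GreenbergVatsal2000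
  Summit.BirchSwinnertonDyer.BirchSwinnertonDyer.Theorems.CollapseThree
  Summit.BirchSwinnertonDyer.BirchSwinnertonDyer.Theorems.PrintX8VerticalStevens
  Summit.BirchSwinnertonDyer.BirchSwinnertonDyer.Cruxes.AnalyticMuZeroX9.TeichSpan
open Summit.BirchSwinnertonDyer.BirchSwinnertonDyer.Theorems.SmallImageOrbitSumMu (exists_sign_hasUnitContent_of_norm_coeff_eq_one)
open Summit.BirchSwinnertonDyer.BirchSwinnertonDyer.Theorems.SmallImageTeichOrbitMu (teichOrbitSum_eq_coeff_comp_mazurTateElement)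
open Summit.BirchSwinnertonDyer.BirchSwinnertonDyer.Theorems.SmallImageTeichSpanHecke
open Summit.BirchSwinnertonDyer.BirchSwinnertonDyer.Theorems.SmallImageTeichSpanHeckePrelims (norm_sub_lt_one_of_forall_isGoodAt)
open Summit.BirchSwinnertonDyer.BirchSwinnertonDyer.Theorems.SmallImageTeichSpanHeckeModPrelims (isManinKilled_heckeRelators)

/-! ### §B The dictionary from «B⁰ modulo a killed relator set» — level form -/

section Dictionary

variable {N : ℕ} [NeZero N] {f : CuspForm (Gamma0 N) 2} {p : ℕ} [Fact p.Prime]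

/-- **The dictionary from B⁰ modulo a killed relator set, level form.**  `f` a rational normalised newform on `Γ₀(N)`, `p` odd, `p ∤ N`,
`a_p(f) = ap ∈ ℤ` with `p ∣ ap`, `n₀{∞,0}_f ∈ Λ_f` for some `n₀` prime to `p`; `G ⊆ Γ₀(N)` ANY relator set with `IsManinKilled f p G`.
IF «B⁰ modulo `G`» holds at `(N,p)` (`TeichSpanGenMod N p G`) AND the winding function is non-constant mod `p`, THEN some Teichmüller-orbit
sum `S_f(p,n,b)` (`n ≥ 1`, `b ∈ (ℤ/pⁿ)ˣ`) has `p`-adic norm `≥ 1`.  Proof: the contrapositive of the f3-mu dictionary — all `S ≡ 0` ⟹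
`[0]⁺ ≡ 0` (`S(1,1) = (a_p − 2)[0]⁺`) ⟹ `γ ↦ m(γ) mod p` kills every B⁰ generator and (hypothesis) every `R ∈ G` ⟹ `2m(γ) ≡ 0` on good `γ`
⟹ constant winding function mod `p`. [cite: Manin1972, Prop. 1.4] [cite: MazurTateTeitelbaum1986Invent, §I.4 (4.2), §I.10 (10.1)–(10.2)] -/
theorem exists_one_le_norm_teichOrbitSum_of_teichSpanGenMod (hf : IsNewform0 f) (hQ : coeffField f = ⊥) (hp2 : p ≠ 2)
    (hpN : ¬ p ∣ N) {ap : ℤ} (hap : cuspCoeff f p = ap) (hpap : (p : ℤ) ∣ ap) {n₀ : ℤ} (hpn₀ : ¬ (p : ℤ) ∣ n₀)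
    (h0 : (n₀ : ℂ) * modularSymbol f 0 ∈ periodLattice f) {G : Set (Gamma0 N)} (hB : TeichSpanGenMod N p G)
    (hG : IsManinKilled f p G)
    (hw : ∃ (n : ℕ) (a a' : ℤ), 1 ≤ ‖((ratPlusSymbol f ((a : ℚ) / (p : ℚ) ^ n) -
      ratPlusSymbol f ((a' : ℚ) / (p : ℚ) ^ n) : ℚ) : ℚ_[p])‖) :
    ∃ n : ℕ, 1 ≤ n ∧ ∃ b : (ZMod (p ^ n))ˣ,
      1 ≤ ‖((teichOrbitSum f p n (b : ZMod (p ^ n)) : ℚ) : ℚ_[p])‖ := by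
  classical
  have hp : p.Prime := Fact.out
  have hpZ : Prime (p : ℤ) := Nat.prime_iff_prime_int.mp hp
  -- period data (Manin 1972 / the period convention `re Λ_f = ℤ·Ω⁺/2`), as in the f3-mu dictionary
  have hreal : ∀ n, (cuspCoeff f n).im = 0 := cuspCoeff_im_eq_zero_of_coeffField_eq_bot hQ
  have hrat : ∀ r : ℚ, (ratPlusSymbol f r : ℝ) = normalizedPlusSymbol f r :=
    fun r ↦ ratCast_ratPlusSymbol_holds hf hQ r
  have hΩpos : 0 < plusPeriod f := (plusPeriod_pos_and_realPeriods_eq isZLattice_periodLattice_holds hf hQ).1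
  have hΩ : plusPeriod f ≠ 0 := hΩpos.ne'
  have hΩ2 : plusPeriod f / 2 ≠ 0 := div_ne_zero hΩ two_ne_zero
  obtain ⟨hre, -⟩ := realPeriods_eq_zmultiples_of_plusPeriod_ne_zero f hΩ
  choose m hm using exists_re_cuspSymbol_eq f hre
  have hm_zero : ∀ γ, cuspSymbol f γ = 0 → m γ = 0 := by
    intro γ hγ
    have h := hm γ
    rw [hγ, Complex.zero_re] at h
    exact_mod_cast (mul_eq_zero.mp h.symm).resolve_right hΩ2
  have hm_mul : ∀ γ δ, m (γ * δ) = m γ + m δ := by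
    intro γ δ
    have h2 : (cuspSymbol f (γ * δ)).re = (cuspSymbol f γ).re + (cuspSymbol f δ).re := by
      rw [cuspSymbol_mul_holds f γ δ, Complex.add_re]
    rw [hm, hm, hm, ← add_mul] at h2
    exact_mod_cast mul_right_cancel₀ hΩ2 h2
  have hm_one : m 1 = 0 := hm_zero 1 (cuspSymbol_one f)
  have hm_pow : ∀ (γ : Gamma0 N) (n : ℕ), m (γ ^ n) = n * m γ := by
    intro γ n
    induction n with
    | zero => simp [hm_one]
    | succ n ih => rw [pow_succ, hm_mul, ih]; push_cast; ring
  have hm_list : ∀ l : List (Gamma0 N), m l.prod = (l.map m).sum := by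
    intro l
    induction l with
    | nil => simp [hm_one]
    | cons g l ih => rw [List.prod_cons, hm_mul, ih, List.map_cons, List.sum_cons]
  -- Manin at `r = 0`: `[b/d]⁺ − [0]⁺ = m(γ)/2` for `γ = (a b; c d)`, `d ≠ 0`
  have hcusp : ∀ γ : Gamma0 N, dEntry γ ≠ 0 →
      ratPlusSymbol f (((bEntry γ : ℤ) : ℚ) / ((dEntry γ : ℤ) : ℚ)) - ratPlusSymbol f 0 = (m γ : ℚ) / 2 := by
    intro γ hd
    have hd' : ((γ : SL(2, ℤ)) 1 0 : ℚ) * 0 + ((γ : SL(2, ℤ)) 1 1 : ℚ) ≠ 0 := by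
      rw [mul_zero, zero_add]; exact_mod_cast hd
    have h := ratCast_ratPlusSymbol_moebius_sub f hrat hreal γ 0 hd'
    simp only [mul_zero, zero_add] at h
    rw [hm] at h
    have h' : ((ratPlusSymbol f (((bEntry γ : ℤ) : ℚ) / ((dEntry γ : ℤ) : ℚ)) - ratPlusSymbol f 0 : ℚ) : ℝ) =
        (((m γ : ℚ) / 2 : ℚ) : ℝ) := by
      push_cast
      rw [show ((bEntry γ : ℤ) : ℚ) = ((γ : SL(2, ℤ)) 0 1 : ℚ) from rfl,
        show ((dEntry γ : ℤ) : ℚ) = ((γ : SL(2, ℤ)) 1 1 : ℚ) from rfl, h]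
      field_simp
    exact_mod_cast h'
  -- integrality of the symbols at the `p`-power cusps
  have hint : ∀ (k n : ℕ), ‖((ratPlusSymbol f ((k : ℚ) / (p : ℚ) ^ n) : ℚ) : ℚ_[p])‖ ≤ 1 := by
    intro k n
    have hcop : Nat.Coprime (p ^ n) N := Nat.Coprime.pow_left n ((Nat.Prime.coprime_iff_not_dvd hp).mpr hpN)
    have hx := coprime_den_of_coprime (N := N) hcop (k : ℤ)
    rw [Int.cast_natCast, Nat.cast_pow] at hx
    exact norm_ratPlusSymbol_le_one f hp2 hpn₀ h0 hx
  have hint0 : ‖((ratPlusSymbol f 0 : ℚ) : ℚ_[p])‖ ≤ 1 := by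
    have h := hint 0 0
    rwa [Nat.cast_zero, zero_div] at h
  have hintS : ∀ (n : ℕ) (a : ZMod (p ^ n)), ‖((teichOrbitSum f p n a : ℚ) : ℚ_[p])‖ ≤ 1 :=
    norm_teichOrbitSum_le_one hint
  have hapn : ‖((ap : ℚ) : ℚ_[p])‖ < 1 := by
    have h : ‖((ap : ℤ) : ℚ_[p])‖ < 1 := Padic.norm_intCast_lt_one_iff.mpr hpap
    exact_mod_cast h
  -- suppose, for contradiction, that every orbit sum at each level `≥ 1` over a unit is `≡ 0 (mod p)`
  by_contra H
  push Not at H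
  have hsmall : ∀ (k : ℕ) (u : ZMod (p ^ (k + 1))), IsUnit u →
      ‖((teichOrbitSum f p (k + 1) u : ℚ) : ℚ_[p])‖ < 1 := by
    intro k u hu
    have h := H (k + 1) (by omega) hu.unit
    rwa [IsUnit.unit_spec] at h
  -- `[0]⁺ ≡ 0`: `S(1,1) = (a_p − 2)[0]⁺ ≡ 0` and `a_p[0]⁺ ≡ 0`, `p` odd
  have hzero : ‖((ratPlusSymbol f 0 : ℚ) : ℚ_[p])‖ < 1 := by
    have hS1 := hsmall 0 1 isUnit_one
    have hX0 : teichOrbitSum f p (0 + 1) 1 = ((ap : ℚ) - 2) * ratPlusSymbol f 0 := by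
      have h := teichOrbitSum_one_eq hf hpN hap hrat hp2 1
      rw [Units.val_one] at h
      exact h
    rw [hX0] at hS1
    push_cast at hS1
    have hA : ‖((ap : ℚ) : ℚ_[p]) * ((ratPlusSymbol f 0 : ℚ) : ℚ_[p])‖ < 1 := by
      rw [mul_comm]; exact padic_norm_mul_lt_one hint0 hapn
    have h2u : ‖(2 : ℚ_[p])‖ = 1 := by
      have h : ‖((2 : ℤ) : ℚ_[p])‖ = 1 := by
        refine le_antisymm (Padic.norm_int_le_one 2) (not_lt.mp fun hlt ↦ ?_)
        have hd : (p : ℤ) ∣ 2 := Padic.norm_intCast_lt_one_iff.mp hlt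
        exact hp2 ((Nat.prime_dvd_prime_iff_eq hp Nat.prime_two).mp (by exact_mod_cast hd))
      exact_mod_cast h
    have e : (2 : ℚ_[p]) * ((ratPlusSymbol f 0 : ℚ) : ℚ_[p]) =
        ((ap : ℚ) : ℚ_[p]) * ((ratPlusSymbol f 0 : ℚ) : ℚ_[p]) -
          ((((ap : ℚ) : ℚ_[p]) - 2) * ((ratPlusSymbol f 0 : ℚ) : ℚ_[p])) := by ring
    have h2x : ‖(2 : ℚ_[p]) * ((ratPlusSymbol f 0 : ℚ) : ℚ_[p])‖ < 1 := by
      rw [e]; exact norm_sub_lt_one hA hS1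
    rwa [norm_mul, h2u, one_mul] at h2x
  -- hence every orbit sum at level `k + 1` over a unit is `≡ −[0]⁺`
  have horb : ∀ (k : ℕ) (u : ZMod (p ^ (k + 1))), IsUnit u →
      ‖((teichOrbitSum f p (k + 1) u + ratPlusSymbol f 0 : ℚ) : ℚ_[p])‖ < 1 := by
    intro k u hu
    have h := padic_norm_add_lt_one (hsmall k u hu) hzero
    push_cast at h ⊢
    exact h
  -- the reduction of `m` mod `p` as a homomorphism `Γ₀(N) → ℤ/p`
  let φ : Gamma0 N →* Multiplicative (ZMod p) :=
    { toFun := fun γ ↦ Multiplicative.ofAdd (((m γ : ℤ) : ZMod p))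
      map_one' := by simp [hm_one]
      map_mul' := fun γ δ ↦ by simp [hm_mul, ofAdd_add] }
  have hφ : ∀ γ, φ γ = 1 ↔ (p : ℤ) ∣ m γ := by
    intro γ
    simp [φ, ZMod.intCast_zmod_eq_zero_iff_dvd]
  have hφ_list : ∀ l : List (Gamma0 N), φ l.prod = 1 ↔ (p : ℤ) ∣ (l.map m).sum := by
    intro l
    rw [hφ, hm_list]
  -- every generator of B⁰_ss lies in the kernel
  have hker : Subgroup.closure (teichSpanGenerators N p ∪ G) ⊔ commutator (Gamma0 N) ≤ φ.ker := by
    refine sup_le ?_ (Abelianization.commutator_subset_ker φ)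
    rw [Subgroup.closure_le]
    rintro γ (((⟨n, l, hn, hl, rfl⟩ | hγ) | ⟨h, rfl⟩) | hR)
    · -- packet products: `Σ_g m(g)/2 = S(n,u) − (p−1)[0]⁺ ≡ 0`
      obtain ⟨k, rfl⟩ : ∃ k, n = k + 1 := ⟨n - 1, by omega⟩
      have hlnd : l.Nodup := hl.2.2.1.of_map _
      have hlen : l.length = p - 1 := hl.1
      obtain ⟨u, hu⟩ := exists_sum_packet_eq_teichOrbitSum (f := f) hp2 hn hl
      rw [← List.sum_toFinset _ hlnd] at hu
      have hmsum : ((((l.map m).sum : ℤ) : ℚ) / 2 : ℚ) =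
          teichOrbitSum f p (k + 1) (u : ZMod (p ^ (k + 1))) - ((p - 1 : ℕ) : ℚ) * ratPlusSymbol f 0 := by
        rw [← hu, Int.cast_list_sum, List.map_map, ← List.sum_toFinset _ hlnd, Finset.sum_div,
          ← hlen, ← List.toFinset_card_of_nodup hlnd]
        rw [show ((l.toFinset.card : ℕ) : ℚ) * ratPlusSymbol f 0 = ∑ g ∈ l.toFinset, ratPlusSymbol f 0 by
          rw [Finset.sum_const, nsmul_eq_mul], ← Finset.sum_sub_distrib]
        refine Finset.sum_congr rfl fun g hg ↦ ?_
        rw [List.mem_toFinset] at hg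
        have hd := dEntry_eq_of_isTeichPacket hl hg
        have hd0 : dEntry g ≠ 0 := by rw [hd]; exact pow_ne_zero _ (by exact_mod_cast hp.ne_zero)
        rw [Function.comp_apply, ← hcusp g hd0, hd]
        push_cast
        rfl
      have hdvd : (p : ℤ) ∣ (l.map m).sum := by
        apply dvd_of_norm_div_two_lt_one hp2
        rw [hmsum, show teichOrbitSum f p (k + 1) (u : ZMod (p ^ (k + 1))) - ((p - 1 : ℕ) : ℚ) * ratPlusSymbol f 0
          = (teichOrbitSum f p (k + 1) (u : ZMod (p ^ (k + 1))) + ratPlusSymbol f 0) - (p : ℚ) * ratPlusSymbol f 0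
          by rw [Nat.cast_sub hp.one_le, Nat.cast_one]; ring]
        push_cast
        have h1 := horb k (u : ZMod (p ^ (k + 1))) u.isUnit
        push_cast at h1
        exact norm_sub_lt_one h1 (norm_natCast_mul_lt_one hint0)
      rw [SetLike.mem_coe, MonoidHom.mem_ker, hφ_list]
      exact hdvd
    · rw [SetLike.mem_coe, MonoidHom.mem_ker, hφ]
      rcases hγ with hfin | htr
      · exact ⟨0, by rw [hm_zero γ (cuspSymbol_eq_zero_of_isOfFinOrder f hfin), mul_zero]⟩
      · exact ⟨0, by rw [hm_zero γ (cuspSymbol_eq_zero_of_trEntry f htr), mul_zero]⟩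
    · -- `p`-th powers
      rw [SetLike.mem_coe, MonoidHom.mem_ker, hφ, hm_pow]
      exact ⟨m h, by ring⟩
    · -- the extra relators `R ∈ G`: killed by hypothesis
      rw [SetLike.mem_coe, MonoidHom.mem_ker, hφ]
      exact hG m hm_one hm_mul hcusp hzero γ hR
  -- B⁰ modulo `G`: for every good `γ`, `γ·γ^ι ∈ ker φ`, i.e. `p ∣ m γ + m(ιγ) = 2 m γ`, so `[b/d]⁺ ≡ [0]⁺`
  have hp2Z : ¬ (p : ℤ) ∣ 2 := fun h ↦
    hp2 ((Nat.prime_dvd_prime_iff_eq hp Nat.prime_two).mp (by exact_mod_cast h))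
  have hgood : ∀ γ : Gamma0 N, IsGoodAt p γ →
      ‖((ratPlusSymbol f (((bEntry γ : ℤ) : ℚ) / ((dEntry γ : ℤ) : ℚ)) - ratPlusSymbol f 0 : ℚ) : ℚ_[p])‖ < 1 := by
    intro γ hγ
    obtain ⟨e, he⟩ := hγ
    have hd0 : dEntry γ ≠ 0 := by
      intro h; rw [h, Int.natAbs_zero] at he; exact pow_ne_zero e hp.ne_zero he.symm
    have hι : m (iotaGamma0 γ) = m γ := by
      have h1 := hcusp (iotaGamma0 γ) (by rwa [dEntry_iotaGamma0])
      rw [bEntry_iotaGamma0, dEntry_iotaGamma0, Int.cast_neg, neg_div, ratPlusSymbol_neg f, hcusp γ hd0] at h1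
      have h2 : (m (iotaGamma0 γ) : ℚ) = m γ := by linarith
      exact_mod_cast h2
    have h2 : (p : ℤ) ∣ m (γ * iotaGamma0 γ) := (hφ _).mp (hker (hB γ ⟨e, he⟩))
    rw [hm_mul, hι, ← two_mul] at h2
    have hdvd : (p : ℤ) ∣ m γ := (hpZ.dvd_or_dvd h2).resolve_left hp2Z
    rw [hcusp γ hd0]
    exact norm_div_two_lt_one_of_dvd hp2 hdvd
  -- every `p`-power cusp: `[b/p^k]⁺ ≡ [0]⁺` (prelims `norm_sub_lt_one_of_forall_isGoodAt`)
  have hall := norm_sub_lt_one_of_forall_isGoodAt f hpN hgood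
  -- contradiction with the non-constancy of the winding function
  obtain ⟨n, a, a', hw⟩ := hw
  have h := norm_sub_lt_one (hall n a) (hall n a')
  rw [← Rat.cast_sub, show ratPlusSymbol f ((a : ℚ) / (p : ℚ) ^ n) - ratPlusSymbol f 0 -
      (ratPlusSymbol f ((a' : ℚ) / (p : ℚ) ^ n) - ratPlusSymbol f 0) =
      ratPlusSymbol f ((a : ℚ) / (p : ℚ) ^ n) - ratPlusSymbol f ((a' : ℚ) / (p : ℚ) ^ n) by ring] at h
  exact absurd hw (not_le.mpr h)

end Dictionary

/-! ### §C Curve form: the rider from B⁰ modulo the Hecke relators of the newform -/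

section Rider

variable {N : ℕ} [NeZero N] (f : CuspForm (Gamma0 N) 2) {p : ℕ} [Fact p.Prime]

/-- **The one-sign μ-rider at an odd good supersingular prime ⟸ B⁰ MODULO A KILLED RELATOR SET at the newform's level.**  For `W/ℚ`
globally minimal with good reduction at the odd prime `p`, `a_p = 0`, its newform `f` of level `N`, and any `G ⊆ Γ₀(N)` with
`IsManinKilled f p G`: `TeichSpanGenMod N p G → ∃ ε L, IsSignedPAdicLFunction f p ε L ∧ HasUnitContent L`.  (Serre Prop. 12 ⇒ `E[p]`
irreducible ⇒ winding non-constancy, input-free THEOREM B road, and the Eisenstein multiple; §B; a unit orbit sum gives the rider, first cut §C.)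
[cite: Serre1972, §1.11 Prop. 12] [cite: MazurTateTeitelbaum1986Invent, §I.10 (10.1)–(10.2)] [cite: Manin1972, Prop. 1.4] -/
theorem exists_sign_hasUnitContent_of_teichSpanGenMod {W : WeierstrassCurve ℚ} [W.IsElliptic] [W.IsGloballyMinimal]
    (hp2 : p ≠ 2) (hf : IsNewformOf W f) (hgood : W.HasGoodReductionAtPrime p) (hap : W.frobeniusTrace p = 0)
    {G : Set (Gamma0 N)} (hG : IsManinKilled f p G) (hB : TeichSpanGenMod N p G) :
    ∃ (ε : ℤˣ) (L : IwasawaAlgebra p), IsSignedPAdicLFunction f p ε L ∧ HasUnitContent L := by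
  have hpN : ¬ p ∣ N := not_dvd_level_of_isNewformOf hf hgood
  have hirr : W.HasIrreducibleModPGaloisRep p :=
    hasIrreducibleModPGaloisRep_of_dvd_frobeniusTrace W p hp2
      (W.not_dvd_minimalDiscriminantInt_of_hasGoodReductionAtPrime' p hgood) (by rw [hap]; exact dvd_zero _)
  have hcyc : CycWindingNonConstantAt W p :=
    Summit.BirchSwinnertonDyer.BirchSwinnertonDyer.Rank1Residual.EvenBranch.cycWindingNonConstantAt_of_odd W p hp2 hgood hirr
  obtain ⟨n₀, hpn₀, h0⟩ :=
    exists_intCast_mul_modularSymbol_zero_mem not_irreducible_of_frobeniusTrace_congr_holds hf hirr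
  exact exists_sign_hasUnitContent_of_one_le_norm_teichOrbitSum f hp2 hf hgood hap
    (exists_one_le_norm_teichOrbitSum_of_teichSpanGenMod hf.1 hf.coeffField_eq_bot hp2 hpN
      (cuspCoeff_eq_frobeniusTrace_of_isNewformOf_holds hf hgood) (by rw [hap]; exact dvd_zero _) hpn₀ h0 hB hG (hcyc f hf))

/-- **The rider ⟸ B⁰ MODULO THE HECKE RELATORS OF THE NEWFORM** (`heckeRelators f p`: `T_p`-images and `T_ℓ`-images for every prime
`ℓ ∤ Np` with `p ∣ a_ℓ(f)`; killed by `isManinKilled_heckeRelators`).  For the crux's population the relators include `T_ℓ` for every good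
`ℓ` inert in the Cartan field `K`: the hypothesis concerns the `K`-dihedral residually supersingular eigensystems of level `N` only.
[cite: Serre1972, §1.11 Prop. 12] [cite: MazurTateTeitelbaum1986Invent, §I.4 (4.2), §I.10 (10.1)] -/
theorem exists_sign_hasUnitContent_of_teichSpanGenMod_heckeRelators {W : WeierstrassCurve ℚ} [W.IsElliptic] [W.IsGloballyMinimal]
    (hp2 : p ≠ 2) (hf : IsNewformOf W f) (hgood : W.HasGoodReductionAtPrime p) (hap : W.frobeniusTrace p = 0)
    (hB : TeichSpanGenMod N p (heckeRelators f p)) :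
    ∃ (ε : ℤˣ) (L : IwasawaAlgebra p), IsSignedPAdicLFunction f p ε L ∧ HasUnitContent L := by
  have hpN : ¬ p ∣ N := not_dvd_level_of_isNewformOf hf hgood
  have hirr : W.HasIrreducibleModPGaloisRep p :=
    hasIrreducibleModPGaloisRep_of_dvd_frobeniusTrace W p hp2
      (W.not_dvd_minimalDiscriminantInt_of_hasGoodReductionAtPrime' p hgood) (by rw [hap]; exact dvd_zero _)
  obtain ⟨n₀, hpn₀, h0⟩ :=
    exists_intCast_mul_modularSymbol_zero_mem not_irreducible_of_frobeniusTrace_congr_holds hf hirr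
  exact exists_sign_hasUnitContent_of_teichSpanGenMod f hp2 hf hgood hap
    (isManinKilled_heckeRelators hf.1 hf.coeffField_eq_bot hp2 hpN
      (cuspCoeff_eq_frobeniusTrace_of_isNewformOf_holds hf hgood) (by rw [hap]; exact dvd_zero _) hpn₀ h0) hB

end Rider

/-! ### §D The registered stub `stub_muOneSign_ns_ge5`, VERBATIM, from B⁰ modulo the Hecke relators on the crux's population -/

section Stub

/-- **`stub_muOneSign_ns_ge5` of line `birth_acns` v12, VERBATIM, from «B⁰ modulo the Hecke relators of the newform, at the CONDUCTOR
LEVEL, for every pair of the class»**: for each `(E, p)` of the population (class X7, non-CM, good supersingular `p ≥ 5`, `a_p = 0`,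
`ρ̄_{E,p}` not surjective) and its newform `f` of level `N_E`, `TeichSpanGenMod N_E p (heckeRelators f p)` — a statement about the
`K_E`-dihedral residually supersingular part of `H₁(X₀(N_E); 𝔽_p)⁺` only.  Inside the first cut's hypothesis, itself inside p648205's B⁰.
[cite: MazurTateTeitelbaum1986Invent, §I.4 (4.2), §I.10 (10.1)] [cite: PollackWeston2011, Thm. 4.1 (1)] -/
theorem muOneSign_ns_ge5_of_teichSpanGenMod_heckeRelators_conductor
    (hB : ∀ (W : WeierstrassCurve ℚ) [W.IsElliptic] [W.IsGloballyMinimal] (p : ℕ) [Fact p.Prime], 5 ≤ p →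
      ClassX7 W p → ¬ W.HasCM → W.frobeniusTrace p = 0 → ¬ Surj W p →
      ∀ [NeZero (W.conductorNorm ℤ)] (f : CuspForm (Gamma0 (W.conductorNorm ℤ)) 2), IsNewformOf W f →
        TeichSpanGenMod (W.conductorNorm ℤ) p (heckeRelators f p)) :
    ∀ (W : WeierstrassCurve ℚ) [W.IsElliptic] [W.IsGloballyMinimal] (p : ℕ) [Fact p.Prime], 5 ≤ p →
    ClassX7 W p → ¬ W.HasCM → W.frobeniusTrace p = 0 → ¬ Surj W p →
    ∀ [NeZero (W.conductorNorm ℤ)] (f : CuspForm (Gamma0 (W.conductorNorm ℤ)) 2),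
    IsNewformOf W f → ∃ (ε₀ : ℤˣ) (L₀ : IwasawaAlgebra p), IsSignedPAdicLFunction f p ε₀ L₀ ∧ HasUnitContent L₀ := by
  intro W _ _ p _ hp5 hX hCM hap hs _ f hf
  exact exists_sign_hasUnitContent_of_teichSpanGenMod_heckeRelators f (by omega) hf hX.1.1 hap (hB W p hp5 hX hCM hap hs f hf)

/-- **`stub_muOneSign_ns_ge5` VERBATIM from «B⁰ modulo ANY killed relator set at the conductor level»**: the attacker may choose, per pair
and per newform, any `G ⊆ Γ₀(N_E)` with `IsManinKilled f p G` and prove `TeichSpanGenMod N_E p G`.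
[cite: MazurTateTeitelbaum1986Invent, §I.10 (10.1)] [cite: Manin1972, Prop. 1.4] -/
theorem muOneSign_ns_ge5_of_teichSpanGenMod_conductor
    (hB : ∀ (W : WeierstrassCurve ℚ) [W.IsElliptic] [W.IsGloballyMinimal] (p : ℕ) [Fact p.Prime], 5 ≤ p →
      ClassX7 W p → ¬ W.HasCM → W.frobeniusTrace p = 0 → ¬ Surj W p →
      ∀ [NeZero (W.conductorNorm ℤ)] (f : CuspForm (Gamma0 (W.conductorNorm ℤ)) 2), IsNewformOf W f →
        ∃ G : Set (Gamma0 (W.conductorNorm ℤ)), IsManinKilled f p G ∧ TeichSpanGenMod (W.conductorNorm ℤ) p G) :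
    ∀ (W : WeierstrassCurve ℚ) [W.IsElliptic] [W.IsGloballyMinimal] (p : ℕ) [Fact p.Prime], 5 ≤ p →
    ClassX7 W p → ¬ W.HasCM → W.frobeniusTrace p = 0 → ¬ Surj W p →
    ∀ [NeZero (W.conductorNorm ℤ)] (f : CuspForm (Gamma0 (W.conductorNorm ℤ)) 2),
    IsNewformOf W f → ∃ (ε₀ : ℤˣ) (L₀ : IwasawaAlgebra p), IsSignedPAdicLFunction f p ε₀ L₀ ∧ HasUnitContent L₀ := by
  intro W _ _ p _ hp5 hX hCM hap hs _ f hf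
  obtain ⟨G, hG, hBG⟩ := hB W p hp5 hX hCM hap hs f hf
  exact exists_sign_hasUnitContent_of_teichSpanGenMod f (by omega) hf hX.1.1 hap hG hBG

end Stub

end Summit.BirchSwinnertonDyer.BirchSwinnertonDyer.Theorems.SmallImageTeichSpanHeckeMod

end
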